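import Mathlib.Analysis.Calculus.LocalExtr.Basic
import Mathlib.Analysis.Convex.Deriv
import Mathlib.Analysis.Real.Sqrt
import Mathlib.Topology.Order.Compact
import Mathlib.MeasureTheory.MeasurableSpace.Defs
import Literature.Analysis.ODE.SoninEnvelope
import Literature.Analysis.ODE.DiagonalKernelMaximum
import Literature.Geometry.Lorentzian.KerrSurfaceGravity

/-!
# Two-point bound for a pair of complex solutions inside a forbidden interval
# (stub `stub_barrierProductBound`, E2 of the line `olver-dunster-uniform-reduction`)

Crux `PhaseMixingCapture.KappaExplicitWaveDecay` (stmt-FinalStateConjecture-10654), line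
`olver-dunster-uniform-reduction`, stub E2. Let `u, v : ℝ → ℂ` solve `y″ = q y` on `[a, b]`
with `q ≥ 0` (so `f = ‖u‖²`, `g = ‖v‖²` are convex, `SoninEnvelope.convexOn_norm_sq_of_nonneg`),
and suppose the two pairing inequalities `g ≤ A f`, `f ≤ B g` hold pointwise on `[a, b]`
(`A, B ≥ 0`). Then for `a ≤ x ≤ y ≤ b`:
`‖u x‖‖v y‖ ≤ 2(√A‖u a‖² + √B‖v b‖² + (b − a)‖W‖ + ‖u a‖‖v b‖)`, `W = u(a)v′(a) − v(a)u′(a)`.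

PROOF (elementary; the same lemmas are landed as `Literature/Analysis/ODE/BarrierProductBound.lean`,
inlined here as private helpers so that this file elaborates against the current farm snapshot):

* `deriv_sq_mul_le_wronskian_sq_of_critical` / `…_of_isLocalMax` — at a critical point of
  `P = f g` one has `f′² g ≤ f‖W‖²` (`f′ = 2 Re(ū u′)`), because `ū v̄ W = f (v̄ v′) − g (ū u′)`
  (`DiagonalKernelMaximum.conj_mul_conj_mul_wronskian`) has real part `−f′ g` there;
* `norm_sq_mul_norm_sq_le_of_pairing` — DIAGONAL: a maximiser `z` of `P` on `[a, b]` lies left of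
  the minimiser `c` of the convex `f` (`f z ≤ f a`, `P ≤ A f(a)²`), right of the minimiser `d` of `g`
  (`P ≤ B g(b)²`), or in `(c, d) ⊆ (a, b)`, where `P′(z) = 0` and either `f z < 2 f c ≤ 2 f a`
  (`P ≤ 4A f(a)²`) or the secant inequality `f′(z) ≥ (f z − f c)/(z − c) ≥ f z/(2(b − a))`
  (`ConvexOn.slope_le_of_hasDerivAt`) gives `P ≤ 4(b − a)²‖W‖²`;
* `norm_mul_norm_le_of_pairing` — square root: `‖u y‖‖v y‖ ≤ 2√A f(a) + √B g(b) + 2(b − a)‖W‖`;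
* `barrier_product_bound` — OFF-DIAGONAL `x ≤ y`: if `‖u x‖ ≤ ‖u y‖` use the diagonal bound at
  `y`; else convexity of `f` on `[a, y]` gives `f x ≤ f a` and convexity of `g` on `[x, b]` gives
  `g y ≤ g b` (product `≤ ‖u a‖‖v b‖`) or `g y ≤ g x` (diagonal bound at `x`).

The Wronskian is constant by `DiagonalKernelMaximum.wronskian_complex_const`.
-/

-- the doubled `FinalStateConjecture.FinalStateConjecture` path component trips dupNamespace
set_option linter.dupNamespace false

noncomputable section

namespace Summit.FinalStateConjecture.FinalStateConjecture.Theorems.KappaExplicitWaveDecay.OlverDunsterUniformReduction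

namespace BarrierProductBound

open Set Filter Topology Literature.Analysis.ODE
open scoped ComplexConjugate

/-! ### The first-order algebraic core at a critical point of `|u|²|v|²` -/

/-- **Algebraic core (first order).** For `u, u₁, v, v₁ ∈ ℂ` with
`Re(ū u₁)|v|² + |u|² Re(v̄ v₁) = 0` (`P′/2 = 0` for `P = |u|²|v|²`):
`(2 Re(ū u₁))² |v|² ≤ |u|² |u v₁ − v u₁|²`, i.e. `f′² g ≤ f |W|²` with `f = |u|²`, `g = |v|²`,
`f′ = 2 Re(ū u₁)` — the real part of `ū v̄ W = f (v̄ v₁) − g (ū u₁)` is `−f′ g` at such a point. -/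
private theorem deriv_sq_mul_le_wronskian_sq_of_critical (u u₁ v v₁ : ℂ)
    (h1 : (conj u * u₁).re * ‖v‖ ^ 2 + ‖u‖ ^ 2 * (conj v * v₁).re = 0) :
    (2 * (conj u * u₁).re) ^ 2 * ‖v‖ ^ 2 ≤ ‖u‖ ^ 2 * ‖u * v₁ - v * u₁‖ ^ 2 := by
  set α := conj u * u₁ with hα
  set β := conj v * v₁ with hβ
  set ρu := ‖u‖ ^ 2 with hρu
  set ρv := ‖v‖ ^ 2 with hρv
  have hρv0 : 0 ≤ ρv := sq_nonneg _
  -- `ρu ρv |W|² = |ρu β − ρv α|²`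
  have hW : ρu * ρv * ‖u * v₁ - v * u₁‖ ^ 2 =
      (ρu * β.re - ρv * α.re) ^ 2 + (ρu * β.im - ρv * α.im) ^ 2 := by
    have e1 : ρu * ρv * ‖u * v₁ - v * u₁‖ ^ 2 = ‖conj u * conj v * (u * v₁ - v * u₁)‖ ^ 2 := by
      rw [norm_mul, norm_mul, Complex.norm_conj, Complex.norm_conj, mul_pow, mul_pow]
    have e2 : conj u * conj v * (u * v₁ - v * u₁) = ((ρu : ℝ) : ℂ) * β - ((ρv : ℝ) : ℂ) * α :=
      conj_mul_conj_mul_wronskian u u₁ v v₁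
    rw [e1, e2, Complex.sq_norm, Complex.normSq_apply, Complex.sub_re, Complex.sub_im,
      Complex.re_ofReal_mul, Complex.re_ofReal_mul, Complex.im_ofReal_mul, Complex.im_ofReal_mul]
    ring
  -- from `h1`: `ρu β.re = −ρv α.re`
  have h1' : ρu * β.re = -(ρv * α.re) := by linarith
  -- the goal multiplied by `ρv`
  have key : (2 * α.re) ^ 2 * ρv * ρv ≤ ρu * ‖u * v₁ - v * u₁‖ ^ 2 * ρv := by
    have e : ρu * ‖u * v₁ - v * u₁‖ ^ 2 * ρv = ρu * ρv * ‖u * v₁ - v * u₁‖ ^ 2 := by ring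
    rw [e, hW, h1']
    nlinarith [sq_nonneg (ρu * β.im - ρv * α.im)]
  rcases hρv0.lt_or_eq with hpos | hzero
  · exact le_of_mul_le_mul_right key hpos
  · rw [← hzero, mul_zero]
    positivity

/-- **First-order condition at a local maximum of `|u|²|v|²`.** If `u, v : ℝ → ℂ` have derivatives
`u′(y)`, `v′(y)` at `y` and `y` is a local maximum of `x ↦ |u(x)|²|v(x)|²`, then
`(2 Re(ū u′))² |v|² ≤ |u|² |u v′ − v u′|²` at `y`. -/
private theorem deriv_sq_mul_le_wronskian_sq_of_isLocalMax {u u' v v' : ℝ → ℂ} {y : ℝ}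
    (hu : HasDerivAt u (u' y) y) (hv : HasDerivAt v (v' y) y)
    (hmax : IsLocalMax (fun x => ‖u x‖ ^ 2 * ‖v x‖ ^ 2) y) :
    (2 * (conj (u y) * u' y).re) ^ 2 * ‖v y‖ ^ 2 ≤ ‖u y‖ ^ 2 * ‖u y * v' y - v y * u' y‖ ^ 2 := by
  have hd : HasDerivAt (fun x => ‖u x‖ ^ 2 * ‖v x‖ ^ 2)
      (2 * (conj (u y) * u' y).re * ‖v y‖ ^ 2 + ‖u y‖ ^ 2 * (2 * (conj (v y) * v' y).re)) y :=
    (hasDerivAt_norm_sq_complex hu).mul (hasDerivAt_norm_sq_complex hv)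
  have h0 := hmax.hasDerivAt_eq_zero hd
  exact deriv_sq_mul_le_wronskian_sq_of_critical (u y) (u' y) (v y) (v' y) (by linarith)

/-! ### The diagonal bound -/

/-- **Diagonal bound for `|u|²|v|²` in a forbidden interval, from two pairing inequalities.** Let
`u, v` be complex solutions of `y″ = q y` on `[a, b]` (derivative data at every point of `[a, b]`)
with `q ≥ 0`, and assume `|v|² ≤ A|u|²`, `|u|² ≤ B|v|²` pointwise on `[a, b]` (`A, B ≥ 0`). Then for
every `y ∈ [a, b]`, with `W = u(a)v′(a) − v(a)u′(a)`:
`|u(y)|²|v(y)|² ≤ max (4A |u(a)|⁴) (max (B |v(b)|⁴) (4(b − a)²|W|²))`. -/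
private theorem norm_sq_mul_norm_sq_le_of_pairing {u u' v v' : ℝ → ℂ} {q : ℝ → ℝ} {a b A B : ℝ}
    (hu : ∀ x ∈ Icc a b, HasDerivAt u (u' x) x ∧ HasDerivAt u' ((q x : ℂ) * u x) x)
    (hv : ∀ x ∈ Icc a b, HasDerivAt v (v' x) x ∧ HasDerivAt v' ((q x : ℂ) * v x) x)
    (hq : ∀ x ∈ Icc a b, 0 ≤ q x) (hA : 0 ≤ A) (hB : 0 ≤ B)
    (hvu : ∀ x ∈ Icc a b, ‖v x‖ ^ 2 ≤ A * ‖u x‖ ^ 2)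
    (huv : ∀ x ∈ Icc a b, ‖u x‖ ^ 2 ≤ B * ‖v x‖ ^ 2) {y : ℝ} (hy : y ∈ Icc a b) :
    ‖u y‖ ^ 2 * ‖v y‖ ^ 2 ≤
      max (4 * A * (‖u a‖ ^ 2) ^ 2)
        (max (B * (‖v b‖ ^ 2) ^ 2) (4 * (b - a) ^ 2 * ‖u a * v' a - v a * u' a‖ ^ 2)) := by
  have hab : a ≤ b := hy.1.trans hy.2
  -- derivative, continuity and convexity data for `f = |u|²`, `g = |v|²`, `P = f g`
  have hfd : ∀ x ∈ Icc a b, HasDerivAt (fun t => ‖u t‖ ^ 2) (2 * (conj (u x) * u' x).re) x :=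
    fun x hx => hasDerivAt_norm_sq_complex (hu x hx).1
  have hgd : ∀ x ∈ Icc a b, HasDerivAt (fun t => ‖v t‖ ^ 2) (2 * (conj (v x) * v' x).re) x :=
    fun x hx => hasDerivAt_norm_sq_complex (hv x hx).1
  have hfcont : ContinuousOn (fun t => ‖u t‖ ^ 2) (Icc a b) := fun x hx =>
    (hfd x hx).continuousAt.continuousWithinAt
  have hgcont : ContinuousOn (fun t => ‖v t‖ ^ 2) (Icc a b) := fun x hx =>
    (hgd x hx).continuousAt.continuousWithinAt
  have hPcont : ContinuousOn (fun t => ‖u t‖ ^ 2 * ‖v t‖ ^ 2) (Icc a b) := hfcont.mul hgcont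
  have hfc : ConvexOn ℝ (Icc a b) (fun t => ‖u t‖ ^ 2) := convexOn_norm_sq_of_nonneg hu hq
  have hgc : ConvexOn ℝ (Icc a b) (fun t => ‖v t‖ ^ 2) := convexOn_norm_sq_of_nonneg hv hq
  -- a maximiser `z` of `P` and minimisers `c`, `d` of `f`, `g`
  have hne : (Icc a b).Nonempty := nonempty_Icc.2 hab
  obtain ⟨z, hz, hzmax⟩ := isCompact_Icc.exists_isMaxOn hne hPcont
  obtain ⟨c, hc, hcmin⟩ := isCompact_Icc.exists_isMinOn hne hfcont
  obtain ⟨d, hd, hdmin⟩ := isCompact_Icc.exists_isMinOn hne hgcont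
  have hPy : ‖u y‖ ^ 2 * ‖v y‖ ^ 2 ≤ ‖u z‖ ^ 2 * ‖v z‖ ^ 2 := hzmax hy
  refine hPy.trans ?_
  have hfz0 : 0 ≤ ‖u z‖ ^ 2 := sq_nonneg _
  have hgz0 : 0 ≤ ‖v z‖ ^ 2 := sq_nonneg _
  have hca : ‖u c‖ ^ 2 ≤ ‖u a‖ ^ 2 := hcmin (left_mem_Icc.2 hab)
  have hdb : ‖v d‖ ^ 2 ≤ ‖v b‖ ^ 2 := hdmin (right_mem_Icc.2 hab)
  -- Case 1: `z ≤ c` — then `f z ≤ f a` and `P z ≤ A f(a)²`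
  by_cases hzc : z ≤ c
  · have h1 : ‖u z‖ ^ 2 ≤ max (‖u a‖ ^ 2) (‖u c‖ ^ 2) :=
      hfc.le_max_of_mem_Icc (left_mem_Icc.2 hab) hc ⟨hz.1, hzc⟩
    have h3 : ‖u z‖ ^ 2 ≤ ‖u a‖ ^ 2 := by rwa [max_eq_left hca] at h1
    have h4 : ‖u z‖ ^ 2 * ‖v z‖ ^ 2 ≤ 4 * A * (‖u a‖ ^ 2) ^ 2 :=
      calc ‖u z‖ ^ 2 * ‖v z‖ ^ 2 ≤ ‖u z‖ ^ 2 * (A * ‖u z‖ ^ 2) :=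
            mul_le_mul_of_nonneg_left (hvu z hz) hfz0
        _ = A * (‖u z‖ ^ 2 * ‖u z‖ ^ 2) := by ring
        _ ≤ A * (‖u a‖ ^ 2 * ‖u a‖ ^ 2) :=
            mul_le_mul_of_nonneg_left (mul_self_le_mul_self hfz0 h3) hA
        _ = A * (‖u a‖ ^ 2) ^ 2 := by ring
        _ ≤ 4 * A * (‖u a‖ ^ 2) ^ 2 := by nlinarith [sq_nonneg (‖u a‖ ^ 2)]
    exact h4.trans (le_max_left _ _)
  push Not at hzc
  -- Case 2: `d ≤ z` — then `g z ≤ g b` and `P z ≤ B g(b)²`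
  by_cases hzd : d ≤ z
  · have h1 : ‖v z‖ ^ 2 ≤ max (‖v d‖ ^ 2) (‖v b‖ ^ 2) :=
      hgc.le_max_of_mem_Icc hd (right_mem_Icc.2 hab) ⟨hzd, hz.2⟩
    have h3 : ‖v z‖ ^ 2 ≤ ‖v b‖ ^ 2 := by rwa [max_eq_right hdb] at h1
    have h4 : ‖u z‖ ^ 2 * ‖v z‖ ^ 2 ≤ B * (‖v b‖ ^ 2) ^ 2 :=
      calc ‖u z‖ ^ 2 * ‖v z‖ ^ 2 ≤ B * ‖v z‖ ^ 2 * ‖v z‖ ^ 2 :=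
            mul_le_mul_of_nonneg_right (huv z hz) hgz0
        _ = B * (‖v z‖ ^ 2 * ‖v z‖ ^ 2) := by ring
        _ ≤ B * (‖v b‖ ^ 2 * ‖v b‖ ^ 2) :=
            mul_le_mul_of_nonneg_left (mul_self_le_mul_self hgz0 h3) hB
        _ = B * (‖v b‖ ^ 2) ^ 2 := by ring
    exact h4.trans ((le_max_left _ _).trans (le_max_right _ _))
  push Not at hzd
  -- Case 3: `c < z < d` — `z` is interior, first-order condition
  have hza : a < z := lt_of_le_of_lt hc.1 hzc
  have hzb : z < b := lt_of_lt_of_le hzd hd.2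
  have hloc : IsLocalMax (fun t => ‖u t‖ ^ 2 * ‖v t‖ ^ 2) z :=
    Filter.eventually_of_mem (Icc_mem_nhds hza hzb) fun x hx => hzmax hx
  have hkey := deriv_sq_mul_le_wronskian_sq_of_isLocalMax (hu z hz).1 (hv z hz).1 hloc
  rw [wronskian_complex_const hu hv hz] at hkey
  set φ := 2 * (conj (u z) * u' z).re with hφ
  -- sub-case `f z < 2 f c (≤ 2 f a)`: `P z ≤ 4 A f(a)²`
  by_cases hsmall : ‖u z‖ ^ 2 < 2 * ‖u c‖ ^ 2
  · have h3 : ‖u z‖ ^ 2 ≤ 2 * ‖u a‖ ^ 2 := by linarith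
    have h4 : ‖u z‖ ^ 2 * ‖v z‖ ^ 2 ≤ 4 * A * (‖u a‖ ^ 2) ^ 2 :=
      calc ‖u z‖ ^ 2 * ‖v z‖ ^ 2 ≤ ‖u z‖ ^ 2 * (A * ‖u z‖ ^ 2) :=
            mul_le_mul_of_nonneg_left (hvu z hz) hfz0
        _ = A * (‖u z‖ ^ 2 * ‖u z‖ ^ 2) := by ring
        _ ≤ A * ((2 * ‖u a‖ ^ 2) * (2 * ‖u a‖ ^ 2)) :=
            mul_le_mul_of_nonneg_left (mul_self_le_mul_self hfz0 h3) hA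
        _ = 4 * A * (‖u a‖ ^ 2) ^ 2 := by ring
    exact h4.trans (le_max_left _ _)
  push Not at hsmall
  -- sub-case `2 f c ≤ f z`: the secant inequality of the convex differentiable `f` on `[c, z]`
  have hsec : slope (fun t => ‖u t‖ ^ 2) c z ≤ φ :=
    hfc.slope_le_of_hasDerivAt hc hz hzc (hfd z hz)
  have hzc0 : 0 < z - c := sub_pos.2 hzc
  rw [slope_def_field, div_le_iff₀ hzc0] at hsec
  -- `hsec : f z − f c ≤ φ (z − c)`, hence `f z ≤ 2 φ (z − c) ≤ 2 (b − a) φ`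
  have h5 : ‖u z‖ ^ 2 ≤ 2 * (φ * (z - c)) := by linarith
  have hφ0 : 0 ≤ φ := by
    by_contra hneg
    push Not at hneg
    have : φ * (z - c) < 0 := mul_neg_of_neg_of_pos hneg hzc0
    linarith
  have hzcba : z - c ≤ b - a := by linarith [hc.1, hz.2]
  have hφ1 : ‖u z‖ ^ 2 ≤ 2 * (b - a) * φ := by
    have h6 : φ * (z - c) ≤ φ * (b - a) := mul_le_mul_of_nonneg_left hzcba hφ0
    linarith
  -- combine with the first-order condition `φ² g z ≤ f z |W|²`
  have h7 : ‖u z‖ ^ 2 * (‖u z‖ ^ 2 * ‖v z‖ ^ 2) ≤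
      ‖u z‖ ^ 2 * (4 * (b - a) ^ 2 * ‖u a * v' a - v a * u' a‖ ^ 2) := by
    have e1 : (‖u z‖ ^ 2) ^ 2 ≤ (2 * (b - a) * φ) ^ 2 := pow_le_pow_left₀ hfz0 hφ1 2
    calc ‖u z‖ ^ 2 * (‖u z‖ ^ 2 * ‖v z‖ ^ 2) = (‖u z‖ ^ 2) ^ 2 * ‖v z‖ ^ 2 := by ring
      _ ≤ (2 * (b - a) * φ) ^ 2 * ‖v z‖ ^ 2 := mul_le_mul_of_nonneg_right e1 hgz0
      _ = 4 * (b - a) ^ 2 * (φ ^ 2 * ‖v z‖ ^ 2) := by ring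
      _ ≤ 4 * (b - a) ^ 2 * (‖u z‖ ^ 2 * ‖u a * v' a - v a * u' a‖ ^ 2) :=
          mul_le_mul_of_nonneg_left hkey (by positivity)
      _ = ‖u z‖ ^ 2 * (4 * (b - a) ^ 2 * ‖u a * v' a - v a * u' a‖ ^ 2) := by ring
  have h8 : ‖u z‖ ^ 2 * ‖v z‖ ^ 2 ≤ 4 * (b - a) ^ 2 * ‖u a * v' a - v a * u' a‖ ^ 2 := by
    rcases hfz0.lt_or_eq with hpos | hzero
    · exact le_of_mul_le_mul_left h7 hpos
    · rw [← hzero, zero_mul]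
      positivity
  exact h8.trans ((le_max_right _ _).trans (le_max_right _ _))

/-- **Diagonal bound, linearised.** Under the hypotheses of `norm_sq_mul_norm_sq_le_of_pairing`,
for every `y ∈ [a, b]`: `|u(y)||v(y)| ≤ 2√A |u(a)|² + √B |v(b)|² + 2(b − a)|W|`,
`W = u(a)v′(a) − v(a)u′(a)`. -/
private theorem norm_mul_norm_le_of_pairing {u u' v v' : ℝ → ℂ} {q : ℝ → ℝ} {a b A B : ℝ}
    (hu : ∀ x ∈ Icc a b, HasDerivAt u (u' x) x ∧ HasDerivAt u' ((q x : ℂ) * u x) x)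
    (hv : ∀ x ∈ Icc a b, HasDerivAt v (v' x) x ∧ HasDerivAt v' ((q x : ℂ) * v x) x)
    (hq : ∀ x ∈ Icc a b, 0 ≤ q x) (hA : 0 ≤ A) (hB : 0 ≤ B)
    (hvu : ∀ x ∈ Icc a b, ‖v x‖ ^ 2 ≤ A * ‖u x‖ ^ 2)
    (huv : ∀ x ∈ Icc a b, ‖u x‖ ^ 2 ≤ B * ‖v x‖ ^ 2) {y : ℝ} (hy : y ∈ Icc a b) :
    ‖u y‖ * ‖v y‖ ≤ 2 * Real.sqrt A * ‖u a‖ ^ 2 + Real.sqrt B * ‖v b‖ ^ 2 +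
      2 * (b - a) * ‖u a * v' a - v a * u' a‖ := by
  have hab : a ≤ b := hy.1.trans hy.2
  have h := norm_sq_mul_norm_sq_le_of_pairing hu hv hq hA hB hvu huv hy
  set R := 2 * Real.sqrt A * ‖u a‖ ^ 2 + Real.sqrt B * ‖v b‖ ^ 2 +
    2 * (b - a) * ‖u a * v' a - v a * u' a‖ with hR
  have hsA : 0 ≤ Real.sqrt A := Real.sqrt_nonneg A
  have hsB : 0 ≤ Real.sqrt B := Real.sqrt_nonneg B
  have hba : 0 ≤ b - a := sub_nonneg.2 hab
  have t1 : 0 ≤ 2 * Real.sqrt A * ‖u a‖ ^ 2 := by positivity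
  have t2 : 0 ≤ Real.sqrt B * ‖v b‖ ^ 2 := by positivity
  have t3 : 0 ≤ 2 * (b - a) * ‖u a * v' a - v a * u' a‖ := by positivity
  have hR0 : 0 ≤ R := by linarith
  -- `R²` dominates each of the three terms of the maximum
  have e1 : 4 * A * (‖u a‖ ^ 2) ^ 2 = (2 * Real.sqrt A * ‖u a‖ ^ 2) ^ 2 := by
    rw [mul_pow, mul_pow, Real.sq_sqrt hA]; ring
  have e2 : B * (‖v b‖ ^ 2) ^ 2 = (Real.sqrt B * ‖v b‖ ^ 2) ^ 2 := by
    rw [mul_pow, Real.sq_sqrt hB]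
  have e3 : 4 * (b - a) ^ 2 * ‖u a * v' a - v a * u' a‖ ^ 2 =
      (2 * (b - a) * ‖u a * v' a - v a * u' a‖) ^ 2 := by ring
  have hmax : max (4 * A * (‖u a‖ ^ 2) ^ 2)
      (max (B * (‖v b‖ ^ 2) ^ 2) (4 * (b - a) ^ 2 * ‖u a * v' a - v a * u' a‖ ^ 2)) ≤ R ^ 2 := by
    rw [e1, e2, e3]
    refine max_le ?_ (max_le ?_ ?_)
    · exact pow_le_pow_left₀ t1 (by linarith) 2
    · exact pow_le_pow_left₀ t2 (by linarith) 2
    · exact pow_le_pow_left₀ t3 (by linarith) 2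
  have hsq : (‖u y‖ * ‖v y‖) ^ 2 ≤ R ^ 2 := by
    rw [mul_pow]
    exact h.trans hmax
  exact (pow_le_pow_iff_left₀ (by positivity) hR0 two_ne_zero).1 hsq

/-! ### The two-point bound -/

/-- **Two-point barrier product bound.** Let `u, v` be complex solutions of `y″ = q y` on `[a, b]`
(derivative data at every point of `[a, b]`) with `q ≥ 0`, and assume the pairing inequalities
`|v|² ≤ A|u|²`, `|u|² ≤ B|v|²` pointwise on `[a, b]` (`A, B ≥ 0`). Then for `a ≤ x ≤ y ≤ b`:
`|u(x)||v(y)| ≤ 2(√A |u(a)|² + √B |v(b)|² + (b − a)|W| + |u(a)||v(b)|)`,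
`W = u(a)v′(a) − v(a)u′(a)` (the constant Wronskian). -/
private theorem barrier_product_bound {u u' v v' : ℝ → ℂ} {q : ℝ → ℝ} {a b A B : ℝ}
    (hu : ∀ x ∈ Icc a b, HasDerivAt u (u' x) x ∧ HasDerivAt u' ((q x : ℂ) * u x) x)
    (hv : ∀ x ∈ Icc a b, HasDerivAt v (v' x) x ∧ HasDerivAt v' ((q x : ℂ) * v x) x)
    (hq : ∀ x ∈ Icc a b, 0 ≤ q x) (hA : 0 ≤ A) (hB : 0 ≤ B)
    (hvu : ∀ x ∈ Icc a b, ‖v x‖ ^ 2 ≤ A * ‖u x‖ ^ 2)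
    (huv : ∀ x ∈ Icc a b, ‖u x‖ ^ 2 ≤ B * ‖v x‖ ^ 2) {x y : ℝ} (hx : x ∈ Icc a b)
    (hy : y ∈ Icc a b) (hxy : x ≤ y) :
    ‖u x‖ * ‖v y‖ ≤
      2 * (Real.sqrt A * ‖u a‖ ^ 2 + Real.sqrt B * ‖v b‖ ^ 2 +
        (b - a) * ‖u a * v' a - v a * u' a‖ + ‖u a‖ * ‖v b‖) := by
  have hab : a ≤ b := hx.1.trans hx.2
  have hdiag : ∀ z ∈ Icc a b, ‖u z‖ * ‖v z‖ ≤ 2 * Real.sqrt A * ‖u a‖ ^ 2 +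
      Real.sqrt B * ‖v b‖ ^ 2 + 2 * (b - a) * ‖u a * v' a - v a * u' a‖ := fun z hz =>
    norm_mul_norm_le_of_pairing hu hv hq hA hB hvu huv hz
  have hsA : 0 ≤ Real.sqrt A := Real.sqrt_nonneg A
  have hsB : 0 ≤ Real.sqrt B := Real.sqrt_nonneg B
  have hba : 0 ≤ b - a := sub_nonneg.2 hab
  have t1 : 0 ≤ Real.sqrt A * ‖u a‖ ^ 2 := by positivity
  have t2 : 0 ≤ Real.sqrt B * ‖v b‖ ^ 2 := by positivity
  have t3 : 0 ≤ (b - a) * ‖u a * v' a - v a * u' a‖ := by positivity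
  have t4 : 0 ≤ ‖u a‖ * ‖v b‖ := by positivity
  have hfc : ConvexOn ℝ (Icc a b) (fun t => ‖u t‖ ^ 2) := convexOn_norm_sq_of_nonneg hu hq
  have hgc : ConvexOn ℝ (Icc a b) (fun t => ‖v t‖ ^ 2) := convexOn_norm_sq_of_nonneg hv hq
  rcases le_or_gt ‖u x‖ ‖u y‖ with hle | hlt
  · -- `|u(x)| ≤ |u(y)|`: the diagonal bound at `y`
    have hdy := hdiag y hy
    calc ‖u x‖ * ‖v y‖ ≤ ‖u y‖ * ‖v y‖ := mul_le_mul_of_nonneg_right hle (norm_nonneg _)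
      _ ≤ _ := hdy
      _ ≤ _ := by linarith
  · -- `|u(y)| < |u(x)|`: convexity of `f` on `[a, y]` gives `f x ≤ f a`
    have h1 : ‖u x‖ ^ 2 ≤ max (‖u a‖ ^ 2) (‖u y‖ ^ 2) :=
      hfc.le_max_of_mem_Icc (left_mem_Icc.2 hab) hy ⟨hx.1, hxy⟩
    have h3 : ‖u x‖ ^ 2 ≤ ‖u a‖ ^ 2 := by
      rcases le_max_iff.1 h1 with h | h
      · exact h
      · exact absurd ((sq_le_sq₀ (norm_nonneg _) (norm_nonneg _)).1 h) (not_le.2 hlt)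
    have h4 : ‖u x‖ ≤ ‖u a‖ := (sq_le_sq₀ (norm_nonneg _) (norm_nonneg _)).1 h3
    -- convexity of `g` on `[x, b]`: `g y ≤ max (g x) (g b)`
    have h5 : ‖v y‖ ^ 2 ≤ max (‖v x‖ ^ 2) (‖v b‖ ^ 2) :=
      hgc.le_max_of_mem_Icc hx (right_mem_Icc.2 hab) ⟨hxy, hy.2⟩
    rcases le_max_iff.1 h5 with h6 | h6
    · -- `g y ≤ g x`: the diagonal bound at `x`
      have h7 : ‖v y‖ ≤ ‖v x‖ := (sq_le_sq₀ (norm_nonneg _) (norm_nonneg _)).1 h6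
      have hdx := hdiag x hx
      calc ‖u x‖ * ‖v y‖ ≤ ‖u x‖ * ‖v x‖ := mul_le_mul_of_nonneg_left h7 (norm_nonneg _)
        _ ≤ _ := hdx
        _ ≤ _ := by linarith
    · -- `g y ≤ g b`: the product is at most `|u(a)||v(b)|`
      have h7 : ‖v y‖ ≤ ‖v b‖ := (sq_le_sq₀ (norm_nonneg _) (norm_nonneg _)).1 h6
      calc ‖u x‖ * ‖v y‖ ≤ ‖u a‖ * ‖v b‖ := mul_le_mul h4 h7 (norm_nonneg _) (norm_nonneg _)
        _ ≤ _ := by linarith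

end BarrierProductBound

open Literature.Geometry.Lorentzian
open MeasureTheory Filter Set Complex
open scoped Topology Manifold ENNReal Classical

/-- **E2 · `stub_barrierProductBound`.** Two-point bound for a pair of complex solutions of
`y″ = q y` (`q ≥ 0`) on `[a, b]` under the pairing inequalities `‖v‖² ≤ A‖u‖²`, `‖u‖² ≤ B‖v‖²`:
for `a ≤ x ≤ y ≤ b`,
`‖u x‖‖v y‖ ≤ 2(√A‖u a‖² + √B‖v b‖² + (b − a)‖u(a)v′(a) − v(a)u′(a)‖ + ‖u a‖‖v b‖)`. -/
theorem stub_barrierProductBound :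
    ∀ (u u' v v' : ℝ → ℂ) (q : ℝ → ℝ) (a b A B : ℝ),
      (∀ x ∈ Icc a b, HasDerivAt u (u' x) x ∧ HasDerivAt u' ((q x : ℂ) * u x) x) →
      (∀ x ∈ Icc a b, HasDerivAt v (v' x) x ∧ HasDerivAt v' ((q x : ℂ) * v x) x) →
      (∀ x ∈ Icc a b, 0 ≤ q x) → 0 ≤ A → 0 ≤ B →
      (∀ x ∈ Icc a b, ‖v x‖ ^ 2 ≤ A * ‖u x‖ ^ 2) →
      (∀ x ∈ Icc a b, ‖u x‖ ^ 2 ≤ B * ‖v x‖ ^ 2) →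
        ∀ x ∈ Icc a b, ∀ y ∈ Icc a b, x ≤ y →
          ‖u x‖ * ‖v y‖ ≤
            2 * (Real.sqrt A * ‖u a‖ ^ 2 + Real.sqrt B * ‖v b‖ ^ 2 + (b - a) * ‖u a * v' a - v a * u' a‖ +
              ‖u a‖ * ‖v b‖) := by
  intro u u' v v' q a b A B hu hv hq hA hB hvu huv x hx y hy hxy
  exact BarrierProductBound.barrier_product_bound hu hv hq hA hB hvu huv hx hy hxy

end Summit.FinalStateConjecture.FinalStateConjecture.Theorems.KappaExplicitWaveDecay.OlverDunsterUniformReduction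

end
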